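/-
Copyright: the b2b-balaban cell (near-miss cell 7), T⁴-continuum fan-out; row NE7b ROUND-2 swarm, seat
t4-ne7b-formalise-leaf-04 (gen 2) — row S6g′(a) pt 2 «THE LAW», file 2∕2 (split agreed with leaf-10 g2, journal
l.8499 ∕ l.8537; holder of row (a): t4-ne7b-formalise-leaf-01).  Released under the licence of the surrounding project.
-/
import Summits.QuantumFields.BalabanUV.T4Continuum.Support.HistoryZoneEvolve

/-!
# Zone mass, the law: the cardinality of a tolerant zone is at most its decayed formation mass (row S6g′(a) pt 2)

Summits-side support leaf of the T⁴-continuum cell (rung (B)+1 on a FINITE torus only; NOT infinite volume, NOT the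
mass gap, NOT the Clay statement; NOT a proof of the spine estimate NE7b).  Row NE7b, route «COUNT», row S6g′
«MASS-BASED SIBLING COUNT» (R-OWNER-22-12 (2)), step (a) = the CARDINALITY LAW feeding the mass-form placement count
(`HistoryMassPlacement.card_admMSet_le`'s binder `hcard`, `HistorySiblingSymmetry`'s host-side factor,
`HistorySiblingMassLayered`∕`HistorySiblingDecay`'s budgets) — leaf-10 g2's specification (journal l.8499 (1)).
[folklore] structural recursion + real arithmetic on leaf-01's tolerant reading `ZoneReadingC` with file 1∕2
`HistoryZoneEvolve` (evolution, ancestor decomposition) and leaf-10 g2's `HistoryZoneMass.card_blocks_le_of_linked_real`;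
nothing is quoted from print, nothing printed is asserted, no `[cite:]` tag, no `Prop`-valued fact minted; every
constant SYMBOLIC in `(d, L, c, ρ, C₁)` and the stride `s` (trigger c2∕c6).

THE LAW (`card_zone_le`).  For a tagged genealogy `G` (shapes `sh`, steps `st = PEv.step ∘ sh`), chronological, read by
`ZoneReadingC sh n L K Cb c G zone`, with two more reading fields DISPLAYED as binders — `hlink`: every zone of a
sub-structure formed by `t ≤ K` is `ρ`-LINKED on its torus (`HistoryZoneMass.Linked`; the binding discharges it from
`linked_redZone`∕`linked_union`∕`linked_blocks`∕`linked_thickT`), and `hbirth`: a birth's zone at its step has at most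
`C₁·((sh b).fat + 1)` CELLS (cardinality — not diameter; `TreeLength.card_le_treeLen` + `card_thickT_le` in the index
model) — a stride `s ≥ 1` with `(2·cth c L s + 1)^d·5^d·ρ ≤ L^s∕2`, and a per-step decay `0 ≤ θ ≤ 1` with
`1∕2 ≤ θ^s`: every sub-structure `X` of `G` formed by `t ≤ K` has
`#(zone t X) ≤ zmass sh θ WB WM t X + 2A`, `zmass` = `Σ_{births} WB·((sh b).fat+1)·θ^{t − st b} + Σ_{merge nodes}
WM·θ^{t − st e}` (structural recursion), `A = (2·cth c L s + 1)^d·5^d`, `WB = 2·(2·cth c L s + 1)^d·C₁`, `WM = 4A`.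

PROOF (l.8499 (2)(ii)(iii)).  §1 the potential `zmass`, the recent mergers' mass `recM` and number `recN`, exact
bookkeeping over the pieces of `HistoryZoneEvolve.parts` (`zmass_parts`), the piece count (`length_parts_le`), the
recent mergers' floor (`recN_mul_le_recM`), decay transport (`mul_zmass_le`).  §2 the law by strong induction on `t`
with the cut `t₀ = t + 1 − s`: by `zone_subset_parts` and `card_evolve_le`, an ANCESTOR piece (formed before `t₀`,
evolved `s` steps from `u = t − s`) costs `A₁·#blocks (L^s) ≤ a·#zone u + A` (linked: `card_blocks_le_of_linked_real`;
`a = A·ρ∕L^s ≤ 1∕2 ≤ θ^s`), hence `≤ a·(zmass u + 2A) + A ≤ zmass t + (2aA + A)` by induction and decay transport;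
a RECENT BIRTH costs `A₁·C₁·(fat+1) ≤ WB·(fat+1)·θ^{age}` (`age ≤ s − 1`, `θ^{age} ≥ 1∕2`); the `2aA + A ≤ 2A` per
piece is paid by `γ = 2A` for one piece and by `WM·θ^{age} ≥ 2A` for each recent merger (`#pieces ≤ #recent
mergers + 1`).  §3 sanity.  The `ZoneDrivers.qZ` currency (sum over `form`, `σ² = θ`, under `Gen.WF`), the
class-linear total over joins and the level form are the consumers' ∕ a companion's (leaf-10 g2 (3)(4), leaf-07 g2).

HONEST: a law about OUR reading; Bałaban's regions ↦ the reading stays H3; NE7b NOT proved; spine 0∕9.  HONEST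
DEPENDENCY (cell): continuum YM on T⁴ ⇐ BetaPertH ∧ nine spine estimates (0/9 proved); BetaPertH ⇐ (D1) ∧ (D4) ∧
CAP+tail; G-an2-4 gates asym, D1 and NE2/3/4.  This file changes none of it.
-/

open Finset
open Literature.MathematicalPhysics.QuantumFieldTheory.Balaban1983to89
open T4PersistenceDictionary T4PartnerMultiplicity
open Summit.QuantumFields.BalabanUV.T4Continuum.PlacementSkeleton
open Summit.QuantumFields.BalabanUV.T4Continuum.Crowding
open Summit.QuantumFields.BalabanUV.T4Continuum.ZoneSkeleton
open Summit.QuantumFields.BalabanUV.T4Continuum.ZoneTorus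
open Summit.QuantumFields.BalabanUV.T4Continuum.HistoryZones
open Summit.QuantumFields.BalabanUV.T4Continuum.HistoryZoneMass
open Summit.QuantumFields.BalabanUV.T4Continuum.HistoryZoneEvolve

namespace Summit.QuantumFields.BalabanUV.T4Continuum.HistoryZoneMassLaw

noncomputable section

variable {d : ℕ}

/-! ## §1 The potential and its bookkeeping over the pieces -/

section Potential

variable {ε : Type*} (sh : ε → PEv)

/-- **THE DECAYED FORMATION MASS** at step `t` (structural recursion; per-step decay `θ`): births weigh
`WB·((sh b).fat + 1)`, merge nodes `WM`, renewals nothing. [folklore] -/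
def zmass (θ WB WM : ℝ) (t : ℕ) : Gen ε → ℝ
  | Gen.born b _ => WB * (((sh b).fat : ℝ) + 1) * θ ^ (t - (sh b).step)
  | Gen.renew Y _ _ => zmass θ WB WM t Y
  | Gen.merge Y Z e => zmass θ WB WM t Y + zmass θ WB WM t Z + WM * θ ^ (t - (sh e).step)

/-- the decayed mass of the merge nodes dated `t₀` or later [folklore] -/
def recM (θ WM : ℝ) (t₀ t : ℕ) : Gen ε → ℝ
  | Gen.born _ _ => 0
  | Gen.renew Y _ _ => recM θ WM t₀ t Y
  | Gen.merge Y Z e =>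
      if (sh e).step < t₀ then 0 else recM θ WM t₀ t Y + recM θ WM t₀ t Z + WM * θ ^ (t - (sh e).step)

/-- the number of merge nodes dated `t₀` or later [folklore] -/
def recN (t₀ : ℕ) : Gen ε → ℕ
  | Gen.born _ _ => 0
  | Gen.renew Y _ _ => recN t₀ Y
  | Gen.merge Y Z e => if (sh e).step < t₀ then 0 else recN t₀ Y + recN t₀ Z + 1

variable {sh} {θ WB WM : ℝ}

/-- the mass is nonnegative [folklore] -/
theorem zmass_nonneg (hθ : 0 ≤ θ) (hB : 0 ≤ WB) (hM : 0 ≤ WM) (t : ℕ) : ∀ X : Gen ε, 0 ≤ zmass sh θ WB WM t X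
  | Gen.born b _ => by unfold zmass; positivity
  | Gen.renew Y _ _ => zmass_nonneg hθ hB hM t Y
  | Gen.merge Y Z e => by
      have hY := zmass_nonneg hθ hB hM t Y
      have hZ := zmass_nonneg hθ hB hM t Z
      show 0 ≤ zmass sh θ WB WM t Y + zmass sh θ WB WM t Z + WM * θ ^ (t - (sh e).step)
      positivity

/-- **EXACT BOOKKEEPING**: the pieces' masses plus the recent mergers' mass is the whole mass. [folklore] -/
theorem zmass_parts (t₀ t : ℕ) : ∀ X : Gen ε,
    ((parts sh t₀ X).map fun p => zmass sh θ WB WM t p).sum + recM sh θ WM t₀ t X = zmass sh θ WB WM t X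
  | Gen.born b j => by simp [parts, recM, zmass]
  | Gen.renew Y e h => by
      show ((parts sh t₀ Y).map fun p => zmass sh θ WB WM t p).sum + recM sh θ WM t₀ t Y = zmass sh θ WB WM t Y
      exact zmass_parts t₀ t Y
  | Gen.merge Y Z e => by
      have hY := zmass_parts t₀ t Y
      have hZ := zmass_parts t₀ t Z
      simp only [parts, recM]
      split_ifs with hlt
      · simp [zmass]
      · rw [List.map_append, List.sum_append]
        simp only [zmass]
        linarith

/-- **THE PIECE COUNT**: at most one more than the recent merge nodes. [folklore] -/
theorem length_parts_le (t₀ : ℕ) : ∀ X : Gen ε, (parts sh t₀ X).length ≤ recN sh t₀ X + 1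
  | Gen.born b j => by simp [parts, recN]
  | Gen.renew Y e h => by
      show (parts sh t₀ Y).length ≤ recN sh t₀ Y + 1
      exact length_parts_le t₀ Y
  | Gen.merge Y Z e => by
      have hY := length_parts_le t₀ Y
      have hZ := length_parts_le t₀ Z
      simp only [parts, recN]
      split_ifs with hlt
      · simp
      · rw [List.length_append]; omega

variable [DecidableEq ε]

/-- the recent mergers' mass dominates `WM·θ^{s−1}` per recent merge node when every recent merger of a chronological
structure formed by `t` is at most `s − 1` steps old (`t + 1 ≤ t₀ + s`) and `0 ≤ θ ≤ 1` [folklore] -/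
theorem recN_mul_le_recM (hθ : 0 ≤ θ) (hθ1 : θ ≤ 1) (hM : 0 ≤ WM) {t₀ t s : ℕ} (hts : t + 1 ≤ t₀ + s) :
    ∀ {X : Gen ε}, Chrono (PEv.step ∘ sh) X → ftime (PEv.step ∘ sh) X ≤ t →
      (recN sh t₀ X : ℝ) * (WM * θ ^ (s - 1)) ≤ recM sh θ WM t₀ t X
  | Gen.born _ _, _, _ => by simp [recN, recM]
  | Gen.renew Y _ _, hc, hf => by
      show (recN sh t₀ Y : ℝ) * (WM * θ ^ (s - 1)) ≤ recM sh θ WM t₀ t Y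
      exact recN_mul_le_recM hθ hθ1 hM hts hc hf
  | Gen.merge Y Z e, hc, hf => by
      have hfe : (sh e).step ≤ t := hf
      obtain ⟨hfY, hfZ⟩ := ftime_le_of_chrono (PEv.step ∘ sh) hc
      have hY := recN_mul_le_recM hθ hθ1 hM hts hc.1 (hfY.trans hfe)
      have hZ := recN_mul_le_recM hθ hθ1 hM hts hc.2.1 (hfZ.trans hfe)
      simp only [recN, recM]
      split_ifs with hlt
      · simp
      · have hage : t - (sh e).step ≤ s - 1 := by have := not_lt.1 hlt; omega
        have hpow : θ ^ (s - 1) ≤ θ ^ (t - (sh e).step) := pow_le_pow_of_le_one hθ hθ1 hage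
        push_cast
        nlinarith [mul_le_mul_of_nonneg_left hpow hM]

/-- **DECAY TRANSPORT**: `a·zmass u X ≤ zmass (u + k) X` whenever `0 ≤ a ≤ θ^k`, for a chronological structure formed by
`u` (all its formation events are dated `≤ u`, so the truncated ages add up). [folklore] -/
theorem mul_zmass_le (hθ : 0 ≤ θ) (hB : 0 ≤ WB) (hM : 0 ≤ WM) {a : ℝ} (ha0 : 0 ≤ a) {k : ℕ} (ha : a ≤ θ ^ k)
    {u : ℕ} : ∀ {X : Gen ε}, Chrono (PEv.step ∘ sh) X → ftime (PEv.step ∘ sh) X ≤ u →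
      a * zmass sh θ WB WM u X ≤ zmass sh θ WB WM (u + k) X
  | Gen.born b j, _, hf => by
      have hf' : (sh b).step ≤ u := hf
      show a * (WB * (((sh b).fat : ℝ) + 1) * θ ^ (u - (sh b).step)) ≤
        WB * (((sh b).fat : ℝ) + 1) * θ ^ (u + k - (sh b).step)
      rw [show u + k - (sh b).step = (u - (sh b).step) + k by omega, pow_add]
      have h0 : 0 ≤ WB * (((sh b).fat : ℝ) + 1) * θ ^ (u - (sh b).step) := by positivity
      nlinarith [mul_le_mul_of_nonneg_left ha h0]
  | Gen.renew Y _ _, hc, hf => by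
      show a * zmass sh θ WB WM u Y ≤ zmass sh θ WB WM (u + k) Y
      exact mul_zmass_le hθ hB hM ha0 ha hc hf
  | Gen.merge Y Z e, hc, hf => by
      have hfe : (sh e).step ≤ u := hf
      obtain ⟨hfY, hfZ⟩ := ftime_le_of_chrono (PEv.step ∘ sh) hc
      have hY := mul_zmass_le hθ hB hM ha0 ha hc.1 (hfY.trans hfe)
      have hZ := mul_zmass_le hθ hB hM ha0 ha hc.2.1 (hfZ.trans hfe)
      show a * (zmass sh θ WB WM u Y + zmass sh θ WB WM u Z + WM * θ ^ (u - (sh e).step)) ≤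
        zmass sh θ WB WM (u + k) Y + zmass sh θ WB WM (u + k) Z + WM * θ ^ (u + k - (sh e).step)
      rw [show u + k - (sh e).step = (u - (sh e).step) + k by omega, pow_add]
      have h0 : 0 ≤ WM * θ ^ (u - (sh e).step) := by positivity
      nlinarith [mul_le_mul_of_nonneg_left ha h0]

omit [DecidableEq ε] in
/-- a pointwise comparison of two list sums [folklore] -/
theorem sum_map_le_sum_map {α : Type*} {l : List α} {f g : α → ℝ} (h : ∀ p ∈ l, f p ≤ g p) :
    (l.map f).sum ≤ (l.map g).sum := by
  induction l with
  | nil => simp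
  | cons p l ih =>
      simp only [List.map_cons, List.sum_cons]
      exact add_le_add (h p List.mem_cons_self) (ih fun q hq => h q (List.mem_cons_of_mem _ hq))

omit [DecidableEq ε] in
/-- the sum of a constant over a list [folklore] -/
theorem sum_map_const {α : Type*} (l : List α) (x : ℝ) : (l.map fun _ => x).sum = (l.length : ℝ) * x := by
  induction l with
  | nil => simp
  | cons p l ih => simp only [List.map_cons, List.sum_cons, List.length_cons, ih]; push_cast; ring

end Potential

/-! ## §2 The law -/

section Law

variable {ε : Type*} [DecidableEq ε] {sh : ε → PEv} {n L K c : ℕ} {Cb : ℝ} {G : Gen ε}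
  {zone : ℕ → Gen ε → Finset (Fin d → ℕ)}

/-- **THE CARDINALITY LAW OF THE TOLERANT ZONE READING** (row S6g′(a); leaf-10 g2's specification l.8499 (1)).
Hypotheses: `L ≥ 1`; the tolerant reading; chronology; the LINKED field (`ρ ≥ 1`); the BIRTH-CARDINALITY field
(`C₁ ≥ 0`); a stride `s ≥ 1` with `(2·cth c L s + 1)^d·5^d·ρ ≤ L^s∕2`; a decay `0 ≤ θ ≤ 1` with `1∕2 ≤ θ^s`.
Conclusion, with `A₁ := (2·cth c L s + 1)^d`, `A := A₁·5^d`: every sub-structure `X` of `G` formed by `t ≤ K` has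
`#(zone t X) ≤ zmass sh θ (2A₁C₁) (4A) t X + 2A`. [folklore] -/
theorem card_zone_le (hL : 1 ≤ L) (hR : ZoneReadingC sh n L K Cb c G zone) (hchr : Chrono (PEv.step ∘ sh) G)
    {ρ : ℕ} (hρ : 1 ≤ ρ)
    (hlink : ∀ (t : ℕ) (X : Gen ε), Sub X G → ftime (PEv.step ∘ sh) X ≤ t → t ≤ K →
      Linked (side n L K t) ρ (zone t X))
    {C₁ : ℝ} (hC₁ : 0 ≤ C₁)
    (hbirth : ∀ (b : ε) (j : ℕ), Sub (Gen.born b j) G →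
      ((zone (sh b).step (Gen.born b j)).card : ℝ) ≤ C₁ * (((sh b).fat : ℝ) + 1))
    {s : ℕ} (hs : 1 ≤ s)
    (hsmall : (((2 * cth c L s + 1) ^ d : ℕ) : ℝ) * (5 : ℝ) ^ d * ρ ≤ (L : ℝ) ^ s / 2)
    {θ : ℝ} (hθ0 : 0 ≤ θ) (hθ1 : θ ≤ 1) (hθs : 1 / 2 ≤ θ ^ s) :
    ∀ (t : ℕ) (X : Gen ε), Sub X G → ftime (PEv.step ∘ sh) X ≤ t → t ≤ K →
      ((zone t X).card : ℝ) ≤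
        zmass sh θ (2 * (((2 * cth c L s + 1) ^ d : ℕ) : ℝ) * C₁)
            (4 * ((((2 * cth c L s + 1) ^ d : ℕ) : ℝ) * (5 : ℝ) ^ d)) t X +
          2 * ((((2 * cth c L s + 1) ^ d : ℕ) : ℝ) * (5 : ℝ) ^ d) := by
  -- names and signs of the constants
  set A₁ : ℝ := (((2 * cth c L s + 1) ^ d : ℕ) : ℝ) with hA₁
  set A : ℝ := A₁ * (5 : ℝ) ^ d with hA
  set WB : ℝ := 2 * A₁ * C₁ with hWB
  set WM : ℝ := 4 * A with hWM
  have hA₁0 : 0 ≤ A₁ := by positivity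
  have hA0 : 0 ≤ A := by positivity
  have hWB0 : 0 ≤ WB := by positivity
  have hWM0 : 0 ≤ WM := by positivity
  have hL0 : (0 : ℝ) < L := by exact_mod_cast hL
  have hLs : (0 : ℝ) < (L : ℝ) ^ s := by positivity
  have hρ0 : (0 : ℝ) ≤ ρ := by positivity
  set a : ℝ := A * ρ / (L : ℝ) ^ s with ha
  have ha0 : 0 ≤ a := by positivity
  have hahalf : a ≤ 1 / 2 := by rw [ha, div_le_iff₀ hLs]; linarith
  have haθ : a ≤ θ ^ s := hahalf.trans hθs
  -- strong induction on `t`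
  intro t
  induction t using Nat.strong_induction_on with
  | _ t ih =>
  intro X hX hft htK
  set t₀ := t + 1 - s with ht₀
  have ht₀le : t₀ ≤ t + 1 := by omega
  have hdec := zone_subset_parts hR hchr t₀ hX ht₀le hft htK
  have hchrX := chrono_of_sub (PEv.step ∘ sh) hX hchr
  -- the cost of one piece
  have piece : ∀ p ∈ parts sh t₀ X,
      ((evolve n L K c (ustart sh t₀ p) (t - ustart sh t₀ p) (zone (ustart sh t₀ p) p)).card : ℝ) ≤
        zmass sh θ WB WM t p + (2 * a * A + A) := by
    intro p hp
    have hpX := sub_of_mem_parts t₀ hp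
    have hpG : Sub p G := Sub.trans hpX hX
    have hchrp := chrono_of_sub (PEv.step ∘ sh) hpX hchrX
    have hfp : ftime (PEv.step ∘ sh) p ≤ t := (ftime_le_of_sub _ hpX hchrX).trans hft
    have hfu : ftime (PEv.step ∘ sh) p ≤ ustart sh t₀ p := le_max_right _ _
    have hut : ustart sh t₀ p ≤ t := max_le (by omega) hfp
    have huK : ustart sh t₀ p ≤ K := hut.trans htK
    have hRu : InRange (side n L K (ustart sh t₀ p)) (zone (ustart sh t₀ p) p) := hR.inRange _ p hpG
    have hukK : ustart sh t₀ p + (t - ustart sh t₀ p) ≤ K := by rw [Nat.add_sub_cancel' hut]; exact htK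
    have hcard := card_evolve_le (c := c) hL (ustart sh t₀ p) hRu hukK
    have hks : t - ustart sh t₀ p ≤ s := by
      have : t₀ - 1 ≤ ustart sh t₀ p := le_max_left _ _
      omega
    have hcth : (((2 * cth c L (t - ustart sh t₀ p) + 1) ^ d : ℕ) : ℝ) ≤ A₁ := by
      rw [hA₁]
      have hm := cth_mono c L hks
      exact_mod_cast Nat.pow_le_pow_left (by omega) d
    have h1 : ((evolve n L K c (ustart sh t₀ p) (t - ustart sh t₀ p) (zone (ustart sh t₀ p) p)).card : ℝ) ≤
        A₁ * ((blocks (L ^ (t - ustart sh t₀ p)) (zone (ustart sh t₀ p) p)).card : ℝ) :=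
      calc ((evolve n L K c (ustart sh t₀ p) (t - ustart sh t₀ p) (zone (ustart sh t₀ p) p)).card : ℝ)
          ≤ (((2 * cth c L (t - ustart sh t₀ p) + 1) ^ d : ℕ) : ℝ) *
              ((blocks (L ^ (t - ustart sh t₀ p)) (zone (ustart sh t₀ p) p)).card : ℝ) := by exact_mod_cast hcard
        _ ≤ A₁ * ((blocks (L ^ (t - ustart sh t₀ p)) (zone (ustart sh t₀ p) p)).card : ℝ) :=
            mul_le_mul_of_nonneg_right hcth (Nat.cast_nonneg _)
    have hextra : 0 ≤ 2 * a * A + A := by positivity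
    rcases parts_cases t₀ hp with hold | ⟨b, j, rfl, hbt⟩
    · -- an ANCESTOR: start `u = t − s`, `s` steps; linked set meets few `L^s`-blocks; the induction hypothesis at `u`
      have hueq : ustart sh t₀ p = t - s := by
        show max (t₀ - 1) (ftime (PEv.step ∘ sh) p) = t - s
        rw [max_eq_left (by omega)]; omega
      have hkeq : t - (t - s) = s := by omega
      rw [hueq] at h1 hRu hfu huK ⊢
      rw [hkeq] at h1 ⊢
      set u := t - s with hu
      have hult : u < t := by omega
      have ihp := ih u hult p hpG hfu huK
      have hlk := hlink u p hpG hfu huK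
      have hus : u + s ≤ K := by omega
      have hSe : side n L K u = side n L K (u + s) * L ^ s := side_add hus
      have hRu' : InRange (side n L K (u + s) * L ^ s) (zone u p) := by rw [← hSe]; exact hRu
      have hlk' : Linked (side n L K (u + s) * L ^ s) ρ (zone u p) := by rw [← hSe]; exact hlk
      have hbl := card_blocks_le_of_linked_real (Nat.one_le_pow _ _ hL) hρ hRu' hlk'
      have h2 : A₁ * ((blocks (L ^ s) (zone u p)).card : ℝ) ≤ a * ((zone u p).card : ℝ) + A := by
        have h := mul_le_mul_of_nonneg_left hbl hA₁0
        have e : A₁ * ((5 : ℝ) ^ d * ((ρ : ℝ) * (zone u p).card / ((L ^ s : ℕ) : ℝ) + 1)) =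
            a * ((zone u p).card : ℝ) + A := by
          rw [ha, hA]; push_cast; ring
        linarith
      have h3 : a * ((zone u p).card : ℝ) ≤ a * (zmass sh θ WB WM u p + 2 * A) := mul_le_mul_of_nonneg_left ihp ha0
      have h4 : a * zmass sh θ WB WM u p ≤ zmass sh θ WB WM t p := by
        have h := mul_zmass_le (sh := sh) hθ0 hWB0 hWM0 ha0 haθ hchrp hfu (k := s)
        rwa [show u + s = t by omega] at h
      linarith
    · -- a RECENT BIRTH: start `u = st b`, age `≤ s − 1`; `#blocks ≤ #zone (st b) ≤ C₁·(fat+1)`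
      have hueq : ustart sh t₀ (Gen.born b j) = (sh b).step := by
        show max (t₀ - 1) (sh b).step = (sh b).step
        exact max_eq_right (by omega)
      rw [hueq] at h1 ⊢
      set k := t - (sh b).step with hk
      have hks' : k ≤ s - 1 := by omega
      have hbl : ((blocks (L ^ k) (zone (sh b).step (Gen.born b j))).card : ℝ) ≤ C₁ * (((sh b).fat : ℝ) + 1) :=
        le_trans (by exact_mod_cast card_image_le) (hbirth b j hpG)
      have h2 : ((evolve n L K c (sh b).step k (zone (sh b).step (Gen.born b j))).card : ℝ) ≤
          A₁ * (C₁ * (((sh b).fat : ℝ) + 1)) := h1.trans (mul_le_mul_of_nonneg_left hbl hA₁0)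
      have hpow : 1 / 2 ≤ θ ^ k := hθs.trans (pow_le_pow_of_le_one hθ0 hθ1 (by omega))
      have hz : zmass sh θ WB WM t (Gen.born b j) = WB * (((sh b).fat : ℝ) + 1) * θ ^ k := rfl
      rw [hz, hWB]
      have hf0 : 0 ≤ A₁ * (C₁ * (((sh b).fat : ℝ) + 1)) := by positivity
      have hcore : A₁ * (C₁ * (((sh b).fat : ℝ) + 1)) ≤ 2 * A₁ * C₁ * (((sh b).fat : ℝ) + 1) * θ ^ k := by
        nlinarith [mul_le_mul_of_nonneg_left hpow hf0]
      linarith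
  -- summing the pieces
  have hsum : ((zone t X).card : ℝ) ≤
      ((parts sh t₀ X).map fun p => zmass sh θ WB WM t p + (2 * a * A + A)).sum := by
    refine (le_trans (by exact_mod_cast card_le_card hdec) (card_lunion_le _)).trans ?_
    rw [List.map_map]
    exact sum_map_le_sum_map fun p hp => piece p hp
  rw [List.sum_map_add, sum_map_const] at hsum
  -- bookkeeping: pieces + recent mergers = whole; the piece count; the recent mergers' floor
  have hbook := zmass_parts (sh := sh) (θ := θ) (WB := WB) (WM := WM) t₀ t X
  have hlen : ((parts sh t₀ X).length : ℝ) ≤ (recN sh t₀ X : ℝ) + 1 := by exact_mod_cast length_parts_le t₀ X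
  have hrec := recN_mul_le_recM (sh := sh) hθ0 hθ1 hWM0 (t₀ := t₀) (t := t) (s := s) (by omega) hchrX hft
  have hpow : 1 / 2 ≤ θ ^ (s - 1) := hθs.trans (pow_le_pow_of_le_one hθ0 hθ1 (Nat.sub_le s 1))
  have hunit : 2 * a * A + A ≤ 2 * A := by nlinarith
  have hunit' : 2 * a * A + A ≤ WM * θ ^ (s - 1) := by
    rw [hWM]; nlinarith [mul_le_mul_of_nonneg_left hpow hA0]
  have hN0 : (0 : ℝ) ≤ recN sh t₀ X := Nat.cast_nonneg _
  have hfinal : ((parts sh t₀ X).length : ℝ) * (2 * a * A + A) ≤ recM sh θ WM t₀ t X + 2 * A := by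
    have h1 : ((parts sh t₀ X).length : ℝ) * (2 * a * A + A) ≤ ((recN sh t₀ X : ℝ) + 1) * (2 * a * A + A) :=
      mul_le_mul_of_nonneg_right hlen (by positivity)
    have h2 : (recN sh t₀ X : ℝ) * (2 * a * A + A) ≤ (recN sh t₀ X : ℝ) * (WM * θ ^ (s - 1)) :=
      mul_le_mul_of_nonneg_left hunit' hN0
    linarith
  linarith

end Law

/-! ## §3 Sanity (closed instances) -/

namespace Sanity

/-- the potential of a merger (step `3`) of two births (steps `0`, `2`, classes `5`, `1`; shapes read by `Prod.fst`)
at `t = 3` with `θ = 1∕2`, `WB = 1`, `WM = 4`: `6·(1∕2)³ + 2·(1∕2) + 4 = 23∕4`; and its pieces for the cut `t₀ = 1`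
book exactly (`zmass_parts`) -/
example :
    zmass (Prod.fst : PEv × ℕ → PEv) (1 / 2) 1 4 3
        (Gen.merge (Gen.born (((0, 0, 5) : PEv), 0) 0) (Gen.born (((2, 0, 1) : PEv), 1) 2) (((3, 2, 0) : PEv), 2)) =
      23 / 4 := by
  norm_num [zmass, PEv.fat, PEv.step]

end Sanity

end

end Summit.QuantumFields.BalabanUV.T4Continuum.HistoryZoneMassLaw
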